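import Mathlib
import Literature.Analysis.FluidPDE.HardSphereCollisionRecord
import Literature.Analysis.FluidPDE.HardSphereWindowEnumeration
import Literature.MathematicalPhysics.KineticTheory.HardSphereEuler
import Literature.MathematicalPhysics.KineticTheory.HardSphereEulerProofs
import Literature.MathematicalPhysics.KineticTheory.CollisionTubePullbackFlight
import Summits.AtomisticToContinuum.HydrodynamicLimit.Theorems.OneFlightGossipEngineOneFlightLayeredChaosRegimes
import Summits.AtomisticToContinuum.HydrodynamicLimit.Theorems.OneFlightGossipEngineOneFlightLayeredChaosFluxRegimes
import Summits.AtomisticToContinuum.HydrodynamicLimit.Theorems.OneFlightGossipEngineOneFlightLayeredChaosRecordGeometry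
import Summits.AtomisticToContinuum.HydrodynamicLimit.Theorems.OneFlightGossipEngineOneFlightLayeredChaosFlightStartVel
import Summits.AtomisticToContinuum.HydrodynamicLimit.Theorems.OneFlightGossipEngineOneFlightLayeredChaosJunkInvisibility
import Summits.AtomisticToContinuum.HydrodynamicLimit.Theorems.OneFlightGossipEngineOneFlightLayeredChaosWindowEvent
import Summits.AtomisticToContinuum.HydrodynamicLimit.Theorems.OneFlightGossipEngineOneFlightLayeredChaosDiscRegimes
import Summits.AtomisticToContinuum.HydrodynamicLimit.Theorems.OneFlightGossipEngineOneFlightLayeredChaosLaterFlightStart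
import HarnessLib

/-!
# `OneFlightGossipEngine.OneFlightLayeredChaos` — disc form + no wrap-around ⇒ flux form, on every regime
(crux stmt-AtomisticToContinuum-14535, line `Sketch`, lead cycle c3; disc-form reduction 3/4; registered stub
`regimeFluxBody_of_regimeDiscBody`)

The transfer of the line's FLUX → DISC frame (`…DiscRegimes.lean`): if, given the coarse past, the transverse offset of
the colliding pair at the later flight start is uniform on the unit disc of `ĝ^⊥` up to `C σ^p` in `L¹(𝒢)` on the
regime `X` (`RegimeDiscBody θ₀ X`), and flights do not wrap around the torus inside the window (`NoWrap θ₀ 8⁻¹`), then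
the impact vector of the `n`-th collision is flux-distributed given the coarse past up to `2 C σ^p` on `X`
(`RegimeFluxBody θ₀ X`) — for EVERY regime `X` at once; nothing is specific to the short gap.
(1) KINEMATICS (`sepVec_laterFlightStart_eq` of `…LaterFlightStart.lean`, `inv_smul_tangential_sub_smul`): on
    `Φ.good ∩ W` off the long-path event, `sepVec(s⁺) = ε ω − (t_n − s⁺) g` and `b = ω − ⟪ω, ĝ⟫ ĝ`.
(2) SMALL EVENT (`abs_toReal_measure_inter_sub_le` + `NoWrap θ₀ 8⁻¹` with `δ = C σ^p`): the disc-form events for `b`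
    and for `ω − ⟪ω, ĝ⟫ĝ` differ inside `goodᶜ ∪ {long path}`, of mass `≤ C σ^p`.
(3) CHANGE OF VARIABLES (`flux_eq_discLaw` of `…DiscRegimes.lean`): for unit `g`,
    `Flux_g(U) = discLaw g {b | b − √(1 − ‖b‖²) g ∈ U}`; and on `good ∩ W`, `ω = b_ω − √(1 − ‖b_ω‖²) ĝ` with
    `b_ω = ω − ⟪ω, ĝ⟫ĝ` (`tangential_sub_sqrt_smul_eq`; `⟪ω, ĝ⟫ < 0` by `stub_record_geometry`,
    `stub_preVel_eq_flightStart_vel`), so the flux-form defect at `S` IS the disc-form defect at the pulled-back set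
    `{(g, b) | (g, b − √(1 − ‖b‖²) g) ∈ S}` (`measurableSet_discPullback`). Constants `C ↦ 2C`, `σ₀ ↦ min σ₀ ¼`,
    `N₀ ↦ max N₀ N₁`.
Corollary `regimeFluxBody_shortGap_of_regimeDiscBody`: the registered stub `stub_shortGap_flux` follows from
`RegimeDiscBody θ₀ ((shortGap θ₀ (1/20)).inter (shortGap θ₀ 0).compl)` and `NoWrap θ₀ 8⁻¹`.
-/

open scoped BigOperators ENNReal
open MeasureTheory Set
open Literature.Analysis.FluidPDE Literature.MathematicalPhysics.KineticTheory

namespace Summit.AtomisticToContinuum.HydrodynamicLimit.Theorems.OLC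

noncomputable section

/-- Two events differing inside `D` have traces on any `F` whose (finite) measures differ by at most `μ D`. [folklore] -/
theorem abs_toReal_measure_inter_sub_le {Ω : Type*} [MeasurableSpace Ω] (μ : Measure Ω) [IsFiniteMeasure μ]
    {A B D : Set Ω} (F : Set Ω) (h : symmDiff A B ⊆ D) :
    |(μ (A ∩ F)).toReal - (μ (B ∩ F)).toReal| ≤ (μ D).toReal := by
  have key : ∀ {A' B' : Set Ω}, A' \ B' ⊆ D → (μ (A' ∩ F)).toReal ≤ (μ (B' ∩ F)).toReal + (μ D).toReal := by
    intro A' B' hAB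
    have h1 : μ (A' ∩ F) ≤ μ (B' ∩ F) + μ D :=
      calc μ (A' ∩ F) ≤ μ ((B' ∩ F) ∪ D) := measure_mono fun x hx => by
              by_cases hB : x ∈ B'
              · exact Or.inl ⟨hB, hx.2⟩
              · exact Or.inr (hAB ⟨hx.1, hB⟩)
        _ ≤ μ (B' ∩ F) + μ D := measure_union_le _ _
    have := ENNReal.toReal_mono (ENNReal.add_ne_top.2 ⟨measure_ne_top _ _, measure_ne_top _ _⟩) h1
    rwa [ENNReal.toReal_add (measure_ne_top _ _) (measure_ne_top _ _)] at this
  rw [abs_sub_le_iff]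
  constructor
  · linarith [key (A' := A) (B' := B) fun x hx => h (Or.inl hx)]
  · linarith [key (A' := B) (B' := A) fun x hx => h (Or.inr hx)]

/-- **The projection of the incoming hemisphere inverts**: for unit `ω, ĝ` with `⟪ω, ĝ⟫ < 0` and
`b = ω − ⟪ω, ĝ⟫ ĝ`, `ω = b − √(1 − ‖b‖²) ĝ`. [folklore] -/
theorem tangential_sub_sqrt_smul_eq (ω g : V3) (hω : ‖ω‖ = 1) (hg : ‖g‖ = 1) (hin : inner ℝ ω g < 0) :
    (ω - inner ℝ ω g • g) - Real.sqrt (1 - ‖ω - inner ℝ ω g • g‖ ^ 2) • g = ω := by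
  have hsq : ‖ω - inner ℝ ω g • g‖ ^ 2 = 1 - inner ℝ ω g ^ 2 := by
    rw [norm_sub_sq_real, hω, real_inner_smul_right, norm_smul, hg, mul_one, Real.norm_eq_abs, sq_abs]
    ring
  rw [hsq, sub_sub_cancel, Real.sqrt_sq_eq_abs, abs_of_neg hin, neg_smul, sub_neg_eq_add, sub_add_cancel]

/-- **The transverse part forgets the longitudinal phase**: with `ĝ = g/‖g‖` and `ε ≠ 0`,
`ε⁻¹ Π_{ĝ^⊥}(ε ω − c g) = Π_{ĝ^⊥} ω`. [folklore] -/
theorem inv_smul_tangential_sub_smul (ω g : V3) (c : ℝ) {ε : ℝ} (hε : ε ≠ 0) :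
    ε⁻¹ • ((ε • ω - c • g) - inner ℝ (ε • ω - c • g) (‖g‖⁻¹ • g) • (‖g‖⁻¹ • g)) =
      ω - inner ℝ ω (‖g‖⁻¹ • g) • (‖g‖⁻¹ • g) := by
  have hgg : g - inner ℝ g (‖g‖⁻¹ • g) • (‖g‖⁻¹ • g) = 0 := by
    by_cases hg : g = 0
    · simp [hg]
    · have hn : ‖g‖ ≠ 0 := norm_ne_zero_iff.2 hg
      rw [real_inner_smul_right, real_inner_self_eq_norm_sq, smul_smul, sub_eq_zero]
      have : ‖g‖⁻¹ * ‖g‖ ^ 2 * ‖g‖⁻¹ = 1 := by field_simp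
      rw [this, one_smul]
  have hsplit : (ε • ω - c • g) - inner ℝ (ε • ω - c • g) (‖g‖⁻¹ • g) • (‖g‖⁻¹ • g) =
      ε • (ω - inner ℝ ω (‖g‖⁻¹ • g) • (‖g‖⁻¹ • g)) - c • (g - inner ℝ g (‖g‖⁻¹ • g) • (‖g‖⁻¹ • g)) := by
    rw [inner_sub_left, real_inner_smul_left, real_inner_smul_left, sub_smul, smul_sub, smul_sub, mul_smul, mul_smul]
    abel
  rw [hsplit, hgg, smul_zero, sub_zero, smul_smul, inv_mul_cancel₀ hε, one_smul]

/-- The pulled-back test set `{(g, b) | (g, b − √(1 − ‖b‖²) g) ∈ S}` is measurable. [folklore] -/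
theorem measurableSet_discPullback {S : Set (V3 × V3)} (hS : MeasurableSet S) :
    MeasurableSet {x : V3 × V3 | (x.1, x.2 - Real.sqrt (1 - ‖x.2‖ ^ 2) • x.1) ∈ S} := by
  have h : Measurable fun x : V3 × V3 => (x.1, x.2 - Real.sqrt (1 - ‖x.2‖ ^ 2) • x.1) := by fun_prop
  exact h hS

/-- **Disc form + no wrap-around ⇒ flux form, on every regime** (registered stub `regimeFluxBody_of_regimeDiscBody` of
crux stmt-AtomisticToContinuum-14535, line `Sketch`). If, given the coarse past, the transverse offset of
the colliding pair at the later flight start is uniform on the unit disc of `ĝ^⊥` up to `C σ^p` in `L¹(𝒢)` on the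
regime `X` (`RegimeDiscBody θ₀ X`), and flights do not wrap around the torus inside the window (`NoWrap θ₀ 8⁻¹`),
then the impact vector of the `n`-th collision is flux-distributed given the coarse past up to `2 C σ^p` on `X`
(`RegimeFluxBody θ₀ X`).  Kinematics `sepVec_laterFlightStart_eq` off the long-path event + Lambert's cosine law
`flux_eq_discLaw`; `σ₀` is shrunk to `min σ₀ ¼` so that `ε < ¼`. [folklore] -/
theorem regimeFluxBody_of_regimeDiscBody : ∀ {θ₀ : ℝ}, 0 < θ₀ → ∀ X : Summit.AtomisticToContinuum.HydrodynamicLimit.Theorems.OLC.Regime, Summit.AtomisticToContinuum.HydrodynamicLimit.Theorems.OLC.RegimeDiscBody θ₀ X → Summit.AtomisticToContinuum.HydrodynamicLimit.Theorems.OLC.NoWrap θ₀ 8⁻¹ → Summit.AtomisticToContinuum.HydrodynamicLimit.Theorems.OLC.RegimeFluxBody θ₀ X := by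
  intro θ₀ hθ X h hNW
  obtain ⟨C, hC, p, hp, σ₀, hσ₀, hcore⟩ := h
  refine ⟨2 * C, by positivity, p, hp, min σ₀ 4⁻¹, lt_min hσ₀ (by norm_num), fun σ hσ hσlt => ?_⟩
  have hσ₀' : σ < σ₀ := hσlt.trans_le (min_le_left _ _)
  have hσ4 : σ < 4⁻¹ := hσlt.trans_le (min_le_right _ _)
  have hσ2 : σ ≤ 2⁻¹ := by linarith
  have hσtail := hcore σ hσ hσ₀'
  intro τ hτ n
  obtain ⟨N₀, hN₀⟩ := hσtail τ hτ n
  have hδ : 0 < C * σ ^ p := by positivity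
  obtain ⟨N₁, hN₁⟩ := hNW σ hσ hσ2 τ hτ (C * σ ^ p) hδ
  refine ⟨max N₀ N₁, fun N hN Φ i S hS => ?_⟩
  intro G ε w q P W gIn flux E hE
  have hεpos : 0 < ε := hsDiameter_pos hσ N
  have hε4 : ε < 4⁻¹ := (hsDiameter_le hσ.le N).trans_lt hσ4
  have hε2 : ε < 2⁻¹ := hε4.trans (by norm_num)
  haveI : IsProbabilityMeasure P :=
    isProbabilityMeasure_localGibbsLaw continuous_const continuous_const continuous_const
      (fun _ => one_pos) (fun _ => hθ) (by linarith) N Φ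
  -- the pulled-back test set and the disc-form estimate
  set S₂ : Set (V3 × V3) := {x : V3 × V3 | (x.1, x.2 - Real.sqrt (1 - ‖x.2‖ ^ 2) • x.1) ∈ S} with hS₂
  have hS₂m : MeasurableSet S₂ := measurableSet_discPullback hS
  have hmain := hN₀ N ((le_max_left _ _).trans hN) Φ i S₂ hS₂m E hE
  have hL := hN₁ N ((le_max_right _ _).trans hN) Φ
  -- the three events: flux form, tangential part of the impact vector, flight-start transverse offset
  set ω : Config (N + 1) (Fin 3) T3 → V3 := fun z => (Φ.nthRecordOf i n z).impactVec with hωdef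
  set bω : Config (N + 1) (Fin 3) T3 → V3 := fun z => ω z - inner ℝ (ω z) (gIn z) • gIn z with hbω
  set sPlus : Config (N + 1) (Fin 3) T3 → ℝ := fun z =>
      max (flightStart G ε (fun t => Φ.flow t z) 0 i (Φ.nthCollisionTimeOf i n z))
        (flightStart G ε (fun t => Φ.flow t z) 0 (Φ.nthPartnerOf i n z) (Φ.nthCollisionTimeOf i n z)) with hsPlus
  set bOff : Config (N + 1) (Fin 3) T3 → V3 := fun z =>
      ε⁻¹ • (G.sepVec (Φ.flow (sPlus z) z i).1 (Φ.flow (sPlus z) z (Φ.nthPartnerOf i n z)).1 -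
        inner ℝ (G.sepVec (Φ.flow (sPlus z) z i).1 (Φ.flow (sPlus z) z (Φ.nthPartnerOf i n z)).1) (gIn z) •
          gIn z) with hbOff
  set L : Set (Config (N + 1) (Fin 3) T3) := {z | ∃ k : Fin (N + 1), ENNReal.ofReal 8⁻¹ ≤
      ∫⁻ t in Set.Ioc 0 w, ENNReal.ofReal ‖(Φ.flow t z k).2‖} with hLdef
  -- on `good ∩ W`: unit impact vector, unit incoming proxy, incoming pair
  have hgeom : ∀ z ∈ Φ.good, z ∈ W → ‖ω z‖ = 1 ∧ ‖gIn z‖ = 1 ∧ inner ℝ (ω z) (gIn z) < 0 := by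
    intro z hz hzW
    obtain ⟨h1, h2, h3, -⟩ := stub_record_geometry hεpos hε2 Φ i n w hz hzW
    have hpre := stub_preVel_eq_flightStart_vel hεpos hε2 Φ q i n w hz hzW
    have hin : (Φ.nthRecordOf i n z).inDir = gIn z := by
      change _ = ‖((Φ.coarsePastOf q i n z).1 i).2 - ((Φ.coarsePastOf q i n z).2 (Φ.nthPartnerOf i n z)).2‖⁻¹ •
        (((Φ.coarsePastOf q i n z).1 i).2 - ((Φ.coarsePastOf q i n z).2 (Φ.nthPartnerOf i n z)).2)
      rw [HardSphereCollisionRecord.inDir, hpre]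
    exact ⟨h1, by rw [← hin]; exact h2, by rw [← hin]; exact h3⟩
  -- (a) flux event = tangential event, inside `good`
  have hsd₁ : symmDiff (W ∩ {z | (gIn z, ω z) ∈ S}) (W ∩ {z | (gIn z, bω z) ∈ S₂}) ⊆ Φ.goodᶜ := by
    intro z hz hzg
    have hiff : ∀ hzW : z ∈ W, ((gIn z, ω z) ∈ S ↔ (gIn z, bω z) ∈ S₂) := by
      intro hzW
      obtain ⟨h1, h2, h3⟩ := hgeom z hzg hzW
      change _ ↔ (gIn z, bω z - Real.sqrt (1 - ‖bω z‖ ^ 2) • gIn z) ∈ S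
      rw [show bω z - Real.sqrt (1 - ‖bω z‖ ^ 2) • gIn z = ω z from tangential_sub_sqrt_smul_eq _ _ h1 h2 h3]
    rcases hz with ⟨⟨hzW, hzA⟩, hnot⟩ | ⟨⟨hzW, hzA⟩, hnot⟩
    · exact hnot ⟨hzW, (hiff hzW).1 hzA⟩
    · exact hnot ⟨hzW, (hiff hzW).2 hzA⟩
  -- (b) tangential event = flight-start offset event, inside `good ∩ Lᶜ`
  have hsd₂ : symmDiff (W ∩ {z | (gIn z, bω z) ∈ S₂}) (W ∩ {z | (gIn z, bOff z) ∈ S₂}) ⊆ Φ.goodᶜ ∪ L := by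
    intro z hz
    by_contra hcon
    simp only [mem_union, mem_compl_iff, not_or, not_not] at hcon
    obtain ⟨hzg, hzL⟩ := hcon
    have hshort : ∀ k : Fin (N + 1), ∫⁻ t in Set.Ioc 0 w, ENNReal.ofReal ‖(Φ.flow t z k).2‖ < ENNReal.ofReal 8⁻¹ := by
      intro k
      by_contra hk
      exact hzL ⟨k, not_lt.1 hk⟩
    have heq : ∀ hzW : z ∈ W, bOff z = bω z := by
      intro hzW
      have hkin := sepVec_laterFlightStart_eq hεpos hε4 Φ q i n w hzg hzW hshort
      set gd : V3 := ((Φ.coarsePastOf q i n z).1 i).2 - ((Φ.coarsePastOf q i n z).2 (Φ.nthPartnerOf i n z)).2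
        with hgd
      have hgIn : gIn z = ‖gd‖⁻¹ • gd := rfl
      have hQ : G.sepVec (Φ.flow (sPlus z) z i).1 (Φ.flow (sPlus z) z (Φ.nthPartnerOf i n z)).1 =
          ε • ω z - (Φ.nthCollisionTimeOf i n z - sPlus z) • gd := hkin
      calc bOff z = ε⁻¹ • (G.sepVec (Φ.flow (sPlus z) z i).1 (Φ.flow (sPlus z) z (Φ.nthPartnerOf i n z)).1 -
            inner ℝ (G.sepVec (Φ.flow (sPlus z) z i).1 (Φ.flow (sPlus z) z (Φ.nthPartnerOf i n z)).1) (gIn z) •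
              gIn z) := rfl
        _ = ε⁻¹ • ((ε • ω z - (Φ.nthCollisionTimeOf i n z - sPlus z) • gd) -
            inner ℝ (ε • ω z - (Φ.nthCollisionTimeOf i n z - sPlus z) • gd) (‖gd‖⁻¹ • gd) • (‖gd‖⁻¹ • gd)) := by
              rw [hQ, hgIn]
        _ = ω z - inner ℝ (ω z) (‖gd‖⁻¹ • gd) • (‖gd‖⁻¹ • gd) := inv_smul_tangential_sub_smul _ _ _ hεpos.ne'
        _ = bω z := by rw [← hgIn]
    rcases hz with ⟨⟨hzW, hzA⟩, hnot⟩ | ⟨⟨hzW, hzA⟩, hnot⟩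
    · refine hnot ⟨hzW, ?_⟩
      show (gIn z, bOff z) ∈ S₂
      rw [heq hzW]; exact hzA
    · refine hnot ⟨hzW, ?_⟩
      show (gIn z, bω z) ∈ S₂
      rw [← heq hzW]; exact hzA
  -- (c) the compensators agree: Lambert's cosine law at `P.restrict`-a.e. point (which lies in `good ∩ W`)
  have hWm : MeasurableSet (Φ.good ∩ W) := measurableSet_good_inter_le_ncard_collisionTimesOf Φ i (n + 1) w
  have hnull : P Φ.goodᶜ = 0 := localGibbsLaw_one_compl_good σ θ₀ N Φ
  have hae : ∀ᵐ z ∂(P.restrict (W ∩ (X σ n N Φ i ∩ E))), z ∈ Φ.good ∩ W := by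
    rw [ae_iff]
    refine measure_mono_null (t := (Φ.good ∩ W)ᶜ) (fun z hz => hz) ?_
    rw [Measure.restrict_apply hWm.compl]
    exact measure_mono_null (fun z hz hg => hz.1 ⟨hg, hz.2.1⟩) hnull
  have hflux : ∀ z ∈ Φ.good, z ∈ W →
      flux (gIn z) {ω' | (gIn z, ω') ∈ S} = discLaw (gIn z) {b | (gIn z, b) ∈ S₂} := by
    intro z hz hzW
    have hunit : ‖gIn z‖ = 1 := (hgeom z hz hzW).2.1
    have hsec : MeasurableSet {ω' : V3 | (gIn z, ω') ∈ S} := measurable_prodMk_left hS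
    exact flux_eq_discLaw (gIn z) hunit hsec
  have hcomp : ∫ z in W ∩ (X σ n N Φ i ∩ E), flux (gIn z) {ω' | (gIn z, ω') ∈ S} ∂P =
      ∫ z in W ∩ (X σ n N Φ i ∩ E), discLaw (gIn z) {b | (gIn z, b) ∈ S₂} ∂P :=
    integral_congr_ae (by
      filter_upwards [hae] with z hz
      exact hflux z hz.1 hz.2)
  -- (d) assemble
  have hA : P (W ∩ {z | (gIn z, ω z) ∈ S} ∩ (X σ n N Φ i ∩ E)) =
      P (W ∩ {z | (gIn z, bω z) ∈ S₂} ∩ (X σ n N Φ i ∩ E)) := by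
    have := measure_inter_congr_of_symmDiff_null P Φ.goodᶜ hnull hsd₁ (X σ n N Φ i ∩ E)
    rw [show W ∩ {z | (gIn z, ω z) ∈ S} ∩ (X σ n N Φ i ∩ E) = (X σ n N Φ i ∩ E) ∩ (W ∩ {z | (gIn z, ω z) ∈ S})
        from by rw [Set.inter_comm],
      show W ∩ {z | (gIn z, bω z) ∈ S₂} ∩ (X σ n N Φ i ∩ E) = (X σ n N Φ i ∩ E) ∩ (W ∩ {z | (gIn z, bω z) ∈ S₂})
        from by rw [Set.inter_comm]]
    exact this
  have hB : |(P (W ∩ {z | (gIn z, bω z) ∈ S₂} ∩ (X σ n N Φ i ∩ E))).toReal -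
      (P (W ∩ {z | (gIn z, bOff z) ∈ S₂} ∩ (X σ n N Φ i ∩ E))).toReal| ≤ C * σ ^ p := by
    have h1 := abs_toReal_measure_inter_sub_le P (X σ n N Φ i ∩ E) hsd₂
    have h2 : (P (Φ.goodᶜ ∪ L)).toReal ≤ C * σ ^ p := by
      have : P (Φ.goodᶜ ∪ L) ≤ ENNReal.ofReal (C * σ ^ p) :=
        (measure_union_le _ _).trans (by rw [hnull, zero_add]; exact hL)
      exact ENNReal.toReal_le_of_le_ofReal hδ.le this
    exact h1.trans h2
  have hmain' : |(P (W ∩ {z | (gIn z, bOff z) ∈ S₂} ∩ (X σ n N Φ i ∩ E))).toReal -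
      ∫ z in W ∩ (X σ n N Φ i ∩ E), discLaw (gIn z) {b | (gIn z, b) ∈ S₂} ∂P| ≤ C * σ ^ p := hmain
  rw [hcomp]
  show |(P (W ∩ {z | (gIn z, ω z) ∈ S} ∩ (X σ n N Φ i ∩ E))).toReal -
      ∫ z in W ∩ (X σ n N Φ i ∩ E), discLaw (gIn z) {b | (gIn z, b) ∈ S₂} ∂P| ≤ 2 * C * σ ^ p
  rw [hA]
  calc |(P (W ∩ {z | (gIn z, bω z) ∈ S₂} ∩ (X σ n N Φ i ∩ E))).toReal -
        ∫ z in W ∩ (X σ n N Φ i ∩ E), discLaw (gIn z) {b | (gIn z, b) ∈ S₂} ∂P|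
      ≤ |(P (W ∩ {z | (gIn z, bω z) ∈ S₂} ∩ (X σ n N Φ i ∩ E))).toReal -
            (P (W ∩ {z | (gIn z, bOff z) ∈ S₂} ∩ (X σ n N Φ i ∩ E))).toReal| +
          |(P (W ∩ {z | (gIn z, bOff z) ∈ S₂} ∩ (X σ n N Φ i ∩ E))).toReal -
            ∫ z in W ∩ (X σ n N Φ i ∩ E), discLaw (gIn z) {b | (gIn z, b) ∈ S₂} ∂P| := abs_sub_le _ _ _
    _ ≤ C * σ ^ p + C * σ ^ p := add_le_add hB hmain'
    _ = 2 * C * σ ^ p := by ring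

/-- **The reduction of `stub_shortGap_flux`.** Disc-uniformity, given the coarse past, of the flight-start transverse
offset on the short-gap event `RegimeDiscBody θ₀ ((shortGap θ₀ (1/20)).inter (shortGap θ₀ 0).compl)` together with the
no-wrap-around input `NoWrap θ₀ 8⁻¹` (the landed `stub_noWrap` run at threshold `8⁻¹` instead of `4⁻¹`: registered
stub `noWrap_of_threshold`) imply the registered stub
`stub_shortGap_flux θ₀ hθ : RegimeFluxBody θ₀ ((shortGap θ₀ (1/20)).inter (shortGap θ₀ 0).compl)` verbatim. [folklore] -/
theorem regimeFluxBody_shortGap_of_regimeDiscBody (θ₀ : ℝ) (hθ : 0 < θ₀)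
    (hIn : RegimeDiscBody θ₀ ((shortGap θ₀ (1 / 20)).inter (shortGap θ₀ 0).compl)) (hNW : NoWrap θ₀ 8⁻¹) :
    RegimeFluxBody θ₀ ((shortGap θ₀ (1 / 20)).inter (shortGap θ₀ 0).compl) :=
  regimeFluxBody_of_regimeDiscBody hθ _ hIn hNW

end

end Summit.AtomisticToContinuum.HydrodynamicLimit.Theorems.OLC
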